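import Mathlib
import HarnessLib
import Summits.MatrixMultiplication.MatrixMultiplication.Theorems.FarEdgeDescentQuantumTwin
import Summits.MatrixMultiplication.MatrixMultiplication.Theorems.OutsiderSandwichSymmetricCoreRung

/-!
# Outsider sandwich — the symmetric core is QUANTUM-FLAT: `F^θ(P) = 3^{θ₁} · 4^{θ₂+θ₃}` exactly
# (decomp-mm lens-4 «minimal counterexample», g24, part 2)

Beneath the aside leaf `BlockOneIsMM` (item 27147); the cut of record is untouched.  `P = symCore` is
g23's symmetric core of the coupled block (`(S; u, w) ↦ (Su, Sw)`, `S` symmetric `2 × 2`; format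
`3 × 4 × 4`; `P ≤ C₁`, `P ≤ ⟨2,2,2⟩`, `ζ₁(P) = 3`).

**Theorem (`logQuantumFunctional_symCore`).** For every `θ ≥ 0`, the Christandl–Vrana–Zuiddam
logarithmic quantum functional of the core is the DIMENSION BOUND:
`E_θ(P) = θ₁ log₂ 3 + 2θ₂ + 2θ₃`, i.e. `F^θ(P) = 3^{θ₁} 4^{θ₂+θ₃}` (`quantumFunctional_symCore`).
Proof: `≤` is CVZ Thm. 3.19.5; for `≥`, rescale the three slices of `P` by `(1+i, 1, 1+i)` (an element
of `GL₃`): the rescaled core has SCALAR quantum marginals `4·1₃, 3·1₄, 3·1₄`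
(`reducedDensity₁/₂/₃_symCoreBal` — every support point is determined by two of its coordinates, and
the slice weights `2, 1, 2` balance the slice sizes `2, 4, 2` and the row sums `2+1 = 1+2 = 3`), so its
entropy `H_θ` is the dimension bound (lens-2's `marginalSpectrumᵢ_eq_const`), and `E_θ(P) ≥ H_θ(g·P)`.

**Consequences.** `E_θ⟨2,2,2⟩ − E_θ(P) = θ₁ · log₂(4/3)` (`logQuantumFunctional_matMul_sub_symCore`):
on the simplex `θ₁ + θ₂ + θ₃ = 1` the quantum log-ratio of the pair `(⟨2,2,2⟩, P)` is `≤ log₂(4/3)` with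
equality iff `θ = (1,0,0)` (the gauge point `ζ₁`; `quantum_logRatio_le`, `quantum_logRatio_eq_iff`);
`F^θ⟨2,2,2⟩ / F^θ(P) = (4/3)^{θ₁}` (`quantumFunctional_ratio`).  So among ALL quantum functionals the
flattening point `ζ₁` is the extremal one for the core, and the certified floor `θ_P ≥ log₂(4/3)` of
g23 is exactly the quantum ceiling `max_θ (E_θ⟨2,2,2⟩ − E_θ(P)) = log₂(4/3)`: every certificate
family for `C₁` of rate `< log₂(4/3)` — such families exist by g23's forcing
(`symHelped_symExchangeNumber`, `exchangeExponent_lt_two_fifths`) — is invisible to the WHOLE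
Christandl–Vrana–Zuiddam family `{F^θ}`, not just to the flattening rank `ζ₁` (answer to the lens
critic's addendum, STATUS l.1444: `min_θ F^θ(P) = 3` at `θ = (1,0,0)`, `F^θ(P) > 3` elsewhere).

[ChristandlVranaZuiddam2023, Def. 3.15–3.16, Thm. 3.19.5, Example 1.4]; [Strassen1991, Thm. 6.1].
-/

noncomputable section

open scoped BigOperators ComplexConjugate

set_option linter.dupNamespace false
namespace Summit.MatrixMultiplication.MatrixMultiplication.Theorems.OutsiderSandwichSymmetricCoreQuantum

open Literature.Computability.AlgebraicComplexity
open Summit.MatrixMultiplication.MatrixMultiplication.Theorems.FarEdgeDescentQuantumTwin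
  (marginalSpectrum₁_eq_const marginalSpectrum₂_eq_const marginalSpectrum₃_eq_const
    shannonEntropy_const_inv_card logQuantumFunctional_matMulTensor matMulTensor_ne_zero)
open Summit.MatrixMultiplication.MatrixMultiplication.Theorems.OutsiderSandwichSymmetricCore (symCore)
open Summit.MatrixMultiplication.MatrixMultiplication.Theorems.OutsiderSandwichSymmetricCoreRung
  (symCore_apply)

/-! ## 1. Scalar marginals after a change of basis force `E_θ` to the dimension bound -/

section General
variable {ι κ μ : Type*} [Fintype ι] [Fintype κ] [Fintype μ] [DecidableEq ι] [DecidableEq κ]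
  [DecidableEq μ]

/-- **Maximally mixed marginals in SOME basis attain the dimension bound**: if for some
`g ∈ GL × GL × GL` the three quantum marginals of `g·t ≠ 0` are scalar, then
`E_θ(t) = θ₁ log₂|ι| + θ₂ log₂|κ| + θ₃ log₂|μ|` (`≥`: `E_θ(t) ≥ H_θ(g·t)`, CVZ Def. 3.16; `≤`: Thm. 3.19.5).
[cite: ChristandlVranaZuiddam2023, Thm. 3.19.5] -/
theorem logQuantumFunctional_eq_of_scalar_marginals_gl {θ : Fin 3 → ℝ} (hθ : ∀ i, 0 ≤ θ i)
    (t : ι → κ → μ → ℂ) (g : GL ι ℂ × GL κ ℂ × GL μ ℂ)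
    (ht : actTensor (g.1 : Matrix ι ι ℂ) (g.2.1 : Matrix κ κ ℂ) (g.2.2 : Matrix μ μ ℂ) t ≠ 0)
    {c₁ c₂ c₃ : ℕ}
    (h₁ : reducedDensity₁ (actTensor (g.1 : Matrix ι ι ℂ) (g.2.1 : Matrix κ κ ℂ) (g.2.2 : Matrix μ μ ℂ) t) =
      (c₁ : ℂ) • (1 : Matrix ι ι ℂ))
    (h₂ : reducedDensity₂ (actTensor (g.1 : Matrix ι ι ℂ) (g.2.1 : Matrix κ κ ℂ) (g.2.2 : Matrix μ μ ℂ) t) =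
      (c₂ : ℂ) • (1 : Matrix κ κ ℂ))
    (h₃ : reducedDensity₃ (actTensor (g.1 : Matrix ι ι ℂ) (g.2.1 : Matrix κ κ ℂ) (g.2.2 : Matrix μ μ ℂ) t) =
      (c₃ : ℂ) • (1 : Matrix μ μ ℂ)) :
    logQuantumFunctional θ t = θ 0 * (Real.log (Fintype.card ι) / Real.log 2) +
      θ 1 * (Real.log (Fintype.card κ) / Real.log 2) +
      θ 2 * (Real.log (Fintype.card μ) / Real.log 2) := by
  obtain ⟨a, ha⟩ := Function.ne_iff.1 ht
  obtain ⟨b, hb⟩ := Function.ne_iff.1 ha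
  obtain ⟨c, _⟩ := Function.ne_iff.1 hb
  haveI : Nonempty ι := ⟨a⟩; haveI : Nonempty κ := ⟨b⟩; haveI : Nonempty μ := ⟨c⟩
  refine le_antisymm (logQuantumFunctional_le hθ t) ?_
  have hq := quantumEntropy_actTensor_le_logQuantumFunctional hθ t g
  rwa [quantumEntropy, marginalSpectrum₁_eq_const ht h₁, marginalSpectrum₂_eq_const ht h₂,
    marginalSpectrum₃_eq_const ht h₃, shannonEntropy_const_inv_card,
    shannonEntropy_const_inv_card, shannonEntropy_const_inv_card] at hq

end General

/-! ## 2. The balanced core: rescale the slices of `P` by `(1+i, 1, 1+i)` -/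

/-- The slice weights `(1+i, 1, 1+i)` (`|1+i|² = 2`). [folklore] -/
def balWt (p : Fin 3) : ℂ :=
  if p = 1 then 1 else 1 + Complex.I

/-- The weights are non-zero. [folklore] -/
theorem balWt_ne_zero (p : Fin 3) : balWt p ≠ 0 := by
  unfold balWt
  split_ifs
  · exact one_ne_zero
  · intro h
    have := congrArg Complex.re h
    simp at this

/-- `w₀ w̄₀ = 2`. [folklore] -/
@[simp] theorem balWt_zero_mul_conj : balWt 0 * conj (balWt 0) = 2 := by
  have h : balWt 0 = 1 + Complex.I := rfl
  rw [h]; apply Complex.ext <;> norm_num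

/-- `w₁ w̄₁ = 1`. [folklore] -/
@[simp] theorem balWt_one_mul_conj : balWt 1 * conj (balWt 1) = 1 := by
  simp [balWt]

/-- `w₂ w̄₂ = 2`. [folklore] -/
@[simp] theorem balWt_two_mul_conj : balWt 2 * conj (balWt 2) = 2 := by
  have h : balWt 2 = 1 + Complex.I := rfl
  rw [h]; apply Complex.ext <;> norm_num

/-- The diagonal change of basis on the first leg, as an element of `GL₃(ℂ)`. [folklore] -/
def balUnit : GL (Fin 3) ℂ :=
  Matrix.GeneralLinearGroup.mkOfDetNeZero (Matrix.diagonal balWt) (by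
    rw [Matrix.det_diagonal]
    exact Finset.prod_ne_zero_iff.2 fun p _ => balWt_ne_zero p)

/-- The triple `(D, 1, 1)`. [folklore] -/
def balGL : GL (Fin 3) ℂ × GL (Fin 2 × Fin 2) ℂ × GL (Fin 2 × Fin 2) ℂ :=
  (balUnit, 1, 1)

/-- **The balanced core** `P♭ p y z = w_p · P p y z`. [cite: ChristandlVranaZuiddam2023, §1.1] -/
def symCoreBal : Fin 3 → Fin 2 × Fin 2 → Fin 2 × Fin 2 → ℂ :=
  fun p y z => balWt p * symCore p y z

/-- `P♭ = (D ⊗ 1 ⊗ 1)·P`. [cite: ChristandlVranaZuiddam2023, §1.1] -/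
theorem actTensor_balGL :
    actTensor (balGL.1 : Matrix (Fin 3) (Fin 3) ℂ) (balGL.2.1 : Matrix (Fin 2 × Fin 2) (Fin 2 × Fin 2) ℂ)
      (balGL.2.2 : Matrix (Fin 2 × Fin 2) (Fin 2 × Fin 2) ℂ) symCore = symCoreBal := by
  funext p y z
  simp only [balGL, balUnit, Matrix.GeneralLinearGroup.val_mkOfDetNeZero, Units.val_one,
    actTensor_apply, symCoreBal, Matrix.diagonal_apply, Matrix.one_apply]
  simp only [ite_mul, zero_mul, mul_ite, mul_one, mul_zero, Finset.sum_ite_eq, Finset.mem_univ,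
    if_true]

/-- Closed form of the balanced core. [folklore] -/
theorem symCoreBal_apply (p : Fin 3) (y z : Fin 2 × Fin 2) :
    symCoreBal p y z = if y.1 ≠ z.1 ∧ y.2.val + z.2.val = p.val then balWt p else 0 := by
  rw [symCoreBal, symCore_apply]
  split_ifs <;> simp

/-- `P♭ ≠ 0` (the entry at `p = 0`, `y = (0,0)`, `z = (1,0)`). [folklore] -/
theorem symCoreBal_ne_zero : symCoreBal ≠ 0 := by
  intro h
  have h1 := congrFun (congrFun (congrFun h 0) (0, 0)) (1, 0)
  rw [symCoreBal_apply] at h1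
  simp at h1
  exact balWt_ne_zero 0 h1

/-- **First marginal `|P♭⟩⟨P♭|₁ = 4·1₃`** (slice weights `2,1,2` × slice sizes `2,4,2`; distinct slices
have disjoint supports). [cite: ChristandlVranaZuiddam2023, Def. 3.15] -/
theorem reducedDensity₁_symCoreBal : reducedDensity₁ symCoreBal = ((4 : ℕ) : ℂ) • (1 : Matrix (Fin 3) (Fin 3) ℂ) := by
  ext p p'
  rw [reducedDensity₁_apply, Matrix.smul_apply, Matrix.one_apply]
  simp only [symCoreBal_apply, Fintype.sum_prod_type, Fin.sum_univ_two]
  fin_cases p <;> fin_cases p' <;> simp <;> norm_num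

/-- **Second marginal `|P♭⟩⟨P♭|₂ = 3·1₄`** (row `(k,j)` meets the slices `p = j, j+1` once each, with
weights `2+1 = 1+2 = 3`; distinct rows have disjoint supports). [cite: ChristandlVranaZuiddam2023, Def. 3.15] -/
theorem reducedDensity₂_symCoreBal :
    reducedDensity₂ symCoreBal = ((3 : ℕ) : ℂ) • (1 : Matrix (Fin 2 × Fin 2) (Fin 2 × Fin 2) ℂ) := by
  ext ⟨k, j⟩ ⟨k', j'⟩
  rw [reducedDensity₂_apply, Matrix.smul_apply, Matrix.one_apply]
  simp only [symCoreBal_apply, Fintype.sum_prod_type, Fin.sum_univ_two, Fin.sum_univ_three]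
  fin_cases k <;> fin_cases j <;> fin_cases k' <;> fin_cases j' <;> simp <;> norm_num

/-- **Third marginal `|P♭⟩⟨P♭|₃ = 3·1₄`** (symmetric to the second). [cite: ChristandlVranaZuiddam2023, Def. 3.15] -/
theorem reducedDensity₃_symCoreBal :
    reducedDensity₃ symCoreBal = ((3 : ℕ) : ℂ) • (1 : Matrix (Fin 2 × Fin 2) (Fin 2 × Fin 2) ℂ) := by
  ext ⟨k, l⟩ ⟨k', l'⟩
  rw [reducedDensity₃_apply, Matrix.smul_apply, Matrix.one_apply]
  simp only [symCoreBal_apply, Fintype.sum_prod_type, Fin.sum_univ_two, Fin.sum_univ_three]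
  fin_cases k <;> fin_cases l <;> fin_cases k' <;> fin_cases l' <;> simp <;> norm_num

/-! ## 3. The quantum functionals of the core -/

/-- **`E_θ(P) = θ₁ log₂ 3 + θ₂ log₂ 4 + θ₃ log₂ 4`** for every `θ ≥ 0`.
[cite: ChristandlVranaZuiddam2023, Thm. 3.19.5] -/
theorem logQuantumFunctional_symCore {θ : Fin 3 → ℝ} (hθ : ∀ i, 0 ≤ θ i) :
    logQuantumFunctional θ symCore = θ 0 * (Real.log 3 / Real.log 2) + θ 1 * (Real.log 4 / Real.log 2) +
      θ 2 * (Real.log 4 / Real.log 2) := by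
  have h := logQuantumFunctional_eq_of_scalar_marginals_gl hθ symCore balGL
    (by rw [actTensor_balGL]; exact symCoreBal_ne_zero)
    (by rw [actTensor_balGL]; exact reducedDensity₁_symCoreBal)
    (by rw [actTensor_balGL]; exact reducedDensity₂_symCoreBal)
    (by rw [actTensor_balGL]; exact reducedDensity₃_symCoreBal)
  rw [h]
  norm_num [Fintype.card_prod, Fintype.card_fin]

/-- **`E_θ⟨2,2,2⟩ = (θ₁ + θ₂ + θ₃) log₂ 4`** (lens-2's quantum twin, specialised).
[cite: ChristandlVranaZuiddam2023, Thm. 3.19.5] -/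
theorem logQuantumFunctional_matMul_two {θ : Fin 3 → ℝ} (hθ : ∀ i, 0 ≤ θ i) :
    logQuantumFunctional θ (matMulTensor ℂ 2 2 2) = (θ 0 + θ 1 + θ 2) * (Real.log 4 / Real.log 2) := by
  rw [logQuantumFunctional_matMulTensor 2 2 2 hθ one_le_two one_le_two one_le_two]
  norm_num
  ring

/-- `log 4 − log 3 = log (4/3)`. [folklore] -/
theorem log_four_sub_log_three : Real.log 4 - Real.log 3 = Real.log (4 / 3) := by
  rw [Real.log_div (by norm_num) (by norm_num)]

/-- **The quantum defect of the core is linear in `θ₁`: `E_θ⟨2,2,2⟩ − E_θ(P) = θ₁ · log₂(4/3)`.**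
[cite: ChristandlVranaZuiddam2023, Example 1.4] -/
theorem logQuantumFunctional_matMul_sub_symCore {θ : Fin 3 → ℝ} (hθ : ∀ i, 0 ≤ θ i) :
    logQuantumFunctional θ (matMulTensor ℂ 2 2 2) - logQuantumFunctional θ symCore =
      θ 0 * Real.logb 2 (4 / 3) := by
  rw [logQuantumFunctional_matMul_two hθ, logQuantumFunctional_symCore hθ, Real.logb,
    ← log_four_sub_log_three]
  ring

/-- `0 < log₂(4/3)`. [folklore] -/
theorem logb_four_thirds_pos : 0 < Real.logb 2 (4 / 3) :=
  Real.logb_pos one_lt_two (by norm_num)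

/-- **On the simplex the quantum log-ratio is `≤ log₂(4/3)`** … [cite: ChristandlVranaZuiddam2023, Example 1.4] -/
theorem quantum_logRatio_le {θ : Fin 3 → ℝ} (hθ : ∀ i, 0 ≤ θ i) (hs : θ 0 + θ 1 + θ 2 = 1) :
    logQuantumFunctional θ (matMulTensor ℂ 2 2 2) - logQuantumFunctional θ symCore ≤ Real.logb 2 (4 / 3) := by
  rw [logQuantumFunctional_matMul_sub_symCore hθ]
  have h0 : θ 0 ≤ 1 := by linarith [hθ 1, hθ 2]
  nlinarith [logb_four_thirds_pos]

/-- **… with equality iff `θ = (1,0,0)`, the gauge point `ζ₁`.** [cite: ChristandlVranaZuiddam2023, Example 1.4] -/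
theorem quantum_logRatio_eq_iff {θ : Fin 3 → ℝ} (hθ : ∀ i, 0 ≤ θ i) (hs : θ 0 + θ 1 + θ 2 = 1) :
    logQuantumFunctional θ (matMulTensor ℂ 2 2 2) - logQuantumFunctional θ symCore = Real.logb 2 (4 / 3) ↔
      θ 0 = 1 ∧ θ 1 = 0 ∧ θ 2 = 0 := by
  rw [logQuantumFunctional_matMul_sub_symCore hθ]
  have hl := logb_four_thirds_pos
  constructor
  · intro h
    have h0 : θ 0 = 1 := by
      have : (θ 0 - 1) * Real.logb 2 (4 / 3) = 0 := by linarith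
      rcases mul_eq_zero.1 this with h1 | h1
      · linarith
      · exact absurd h1 hl.ne'
    refine ⟨h0, ?_, ?_⟩ <;> linarith [hθ 1, hθ 2]
  · rintro ⟨h0, -, -⟩
    rw [h0, one_mul]

/-- `P ≠ 0`. [folklore] -/
theorem symCore_ne_zero : symCore ≠ 0 := by
  intro h
  apply symCoreBal_ne_zero
  funext p y z
  rw [symCoreBal, h]
  simp

/-- **`F^θ(P) = 3^{θ₁} · 4^{θ₂} · 4^{θ₃}`.** [cite: ChristandlVranaZuiddam2023, Thm. 3.19.5] -/
theorem quantumFunctional_symCore {θ : Fin 3 → ℝ} (hθ : ∀ i, 0 ≤ θ i) :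
    quantumFunctional θ symCore = (3 : ℝ) ^ θ 0 * (4 : ℝ) ^ θ 1 * (4 : ℝ) ^ θ 2 := by
  rw [quantumFunctional_of_ne_zero θ symCore_ne_zero, logQuantumFunctional_symCore hθ,
    Real.rpow_add two_pos, Real.rpow_add two_pos]
  have e : ∀ (x : ℝ), 0 < x → ∀ s : ℝ, (2 : ℝ) ^ (s * (Real.log x / Real.log 2)) = x ^ s := by
    intro x hx s
    rw [Real.log_div_log, mul_comm, Real.rpow_mul (by norm_num : (0 : ℝ) ≤ 2), Real.rpow_logb two_pos
      (by norm_num) hx]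
  rw [e 3 (by norm_num), e 4 (by norm_num), e 4 (by norm_num)]

/-- **`F^θ⟨2,2,2⟩ = 4^{θ₁} · 4^{θ₂} · 4^{θ₃}`.** [cite: ChristandlVranaZuiddam2023, Thm. 3.19.5] -/
theorem quantumFunctional_matMul_two {θ : Fin 3 → ℝ} (hθ : ∀ i, 0 ≤ θ i) :
    quantumFunctional θ (matMulTensor ℂ 2 2 2) = (4 : ℝ) ^ θ 0 * (4 : ℝ) ^ θ 1 * (4 : ℝ) ^ θ 2 := by
  rw [quantumFunctional_of_ne_zero θ (matMulTensor_ne_zero 2 2 2 one_le_two one_le_two one_le_two),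
    logQuantumFunctional_matMul_two hθ, add_mul, add_mul, Real.rpow_add two_pos, Real.rpow_add two_pos]
  have e : ∀ s : ℝ, (2 : ℝ) ^ (s * (Real.log 4 / Real.log 2)) = 4 ^ s := by
    intro s
    rw [Real.log_div_log, mul_comm, Real.rpow_mul (by norm_num : (0 : ℝ) ≤ 2), Real.rpow_logb two_pos
      (by norm_num) (by norm_num)]
  rw [e, e, e]

/-- **`F^θ⟨2,2,2⟩ / F^θ(P) = (4/3)^{θ₁}`.** [cite: ChristandlVranaZuiddam2023, Example 1.4] -/
theorem quantumFunctional_ratio {θ : Fin 3 → ℝ} (hθ : ∀ i, 0 ≤ θ i) :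
    quantumFunctional θ (matMulTensor ℂ 2 2 2) / quantumFunctional θ symCore = (4 / 3 : ℝ) ^ θ 0 := by
  rw [quantumFunctional_matMul_two hθ, quantumFunctional_symCore hθ,
    Real.div_rpow (by norm_num) (by norm_num)]
  have h3 : (0 : ℝ) < 3 ^ θ 0 := Real.rpow_pos_of_pos (by norm_num) _
  have h4 : (0 : ℝ) < 4 ^ θ 1 := Real.rpow_pos_of_pos (by norm_num) _
  have h4' : (0 : ℝ) < 4 ^ θ 2 := Real.rpow_pos_of_pos (by norm_num) _
  field_simp

/-- **The core is dominated by `⟨2,2,2⟩` at every quantum functional, strictly iff `θ₁ > 0`: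
`F^θ(P) ≤ F^θ⟨2,2,2⟩`.** [cite: ChristandlVranaZuiddam2023, Example 1.4] -/
theorem quantumFunctional_symCore_le {θ : Fin 3 → ℝ} (hθ : ∀ i, 0 ≤ θ i) :
    quantumFunctional θ symCore ≤ quantumFunctional θ (matMulTensor ℂ 2 2 2) := by
  rw [quantumFunctional_matMul_two hθ, quantumFunctional_symCore hθ]
  have h34 : (3 : ℝ) ^ θ 0 ≤ 4 ^ θ 0 := Real.rpow_le_rpow (by norm_num) (by norm_num) (hθ 0)
  have h4 : (0 : ℝ) ≤ 4 ^ θ 1 := (Real.rpow_pos_of_pos (by norm_num) _).le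
  have h4' : (0 : ℝ) ≤ 4 ^ θ 2 := (Real.rpow_pos_of_pos (by norm_num) _).le
  exact mul_le_mul_of_nonneg_right (mul_le_mul_of_nonneg_right h34 h4) h4'

end Summit.MatrixMultiplication.MatrixMultiplication.Theorems.OutsiderSandwichSymmetricCoreQuantum

end
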